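import Literature.NumberTheory.Transcendental.KontsevichZagier
import Literature.NumberTheory.Transcendental.KZEllipticChain
import Literature.NumberTheory.Transcendental.KZEllipticPiecePeriod
import HarnessLib

/-!
# Elliptic periods are Kontsevich–Zagier periods (discharge of `isPeriod_of_mem_lattice`)

Sibling proof file of `Literature/NumberTheory/Transcendental/KontsevichZagier.lean`,
discharging the named fact `Literature.NumberTheory.Transcendental.isPeriod_of_mem_lattice`
(**periods.S06**, Kontsevich–Zagier 2001, §1.1): if the lattice `Λ` of a period pair `L` has
algebraic invariants `g₂(Λ), g₃(Λ)`, then every `l ∈ Λ` is a Kontsevich–Zagier period, i.e. its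
real and imaginary parts are absolutely convergent integrals of rational functions with rational
coefficients over `ℚ`-semialgebraic domains (`Literature.NumberTheory.Transcendental.IsPeriod`).

Kontsevich–Zagier list the periods `∮ dx/√(4x³ − g₂x − g₃)` of an elliptic curve over `ℚ̄` among
the first examples of periods (§1.1), with the standing remark that in the definition "rational"
may be replaced by "algebraic" (functions and coefficients). The proof assembled here:

1. `exists_elliptic_chain` (`KZEllipticChain.lean`): for `0 ≠ l ∈ Λ`,
   `l = ∑_{i<N} ∫₀¹ vᵢ / yᵢ(s) ds` with `xᵢ, vᵢ ∈ ℚ(i)` and `yᵢ` a continuous branch of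
   `√(4(xᵢ + s vᵢ)³ − g₂(xᵢ + s vᵢ) − g₃)` — `dz = dx/y` along a chain of local inverses of `℘`
   (Silverman AEC VI.3.6; Whittaker–Watson §20.22);
2. `isPeriod_integral_div_of_sq_eq_cubic` (`KZEllipticPiecePeriod.lean`): each such integral is a
   period — on rational sub-intervals the branch is `±√p` or `±i√(−p)`, the integrand has
   `ℚ`-semialgebraic real and imaginary parts (algebraic constants are `ℚ`-definable,
   `KZSemialgebraicComplex.lean`), and algebraic integrands give the same periods as rational ones
   (`KZ.isRealPeriod_iff_exists_integralRep_holds`, Tarski–Seidenberg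
   `Literature.ModelTheory.ExponentialFields.tarski_seidenberg_real_holds`);
3. finite sums of periods are periods (`isPeriod_sum`, from `IsPeriod.add_holds`); `l = 0` is
   `IsPeriod.zero`.

## References

* M. Kontsevich, D. Zagier, *Periods*, in: Mathematics Unlimited — 2001 and Beyond, Springer
  (2001), §1.1.
* A. Huber, S. Müller-Stach, *Periods and Nori Motives*, Springer (2017), §12.2, Ch. 14.
* J. H. Silverman, *The Arithmetic of Elliptic Curves*, 2nd ed. (2009), VI.3.6.
-/

noncomputable section

namespace Literature.NumberTheory.Transcendental

/-- **Discharge of `isPeriod_of_mem_lattice` (periods.S06).** If the lattice `Λ` of a period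
pair has algebraic invariants `g₂, g₃`, then every `l ∈ Λ` is a Kontsevich–Zagier period: `l` is
a finite sum of integrals `∫ dx/y` of the invariant differential of `y² = 4x³ − g₂x − g₃` along
segments with endpoints in `ℚ(i)` (`exists_elliptic_chain`), each of which is a period
(`isPeriod_integral_div_of_sq_eq_cubic`), and periods are closed under finite sums.
[Kontsevich–Zagier 2001, §1.1: elliptic integrals `∮ dx/√(4x³ − g₂x − g₃)`, `g₂, g₃ ∈ ℚ̄`, are
periods] [cite: KontsevichZagier2001, §1.1] -/
theorem isPeriod_of_mem_lattice_holds : isPeriod_of_mem_lattice := by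
  intro L h₂ h₃ l hl
  by_cases hl0 : l = 0
  · subst hl0
    exact IsPeriod.zero
  obtain ⟨N, x, v, y, halg, hcont, hsq, hsum⟩ := exists_elliptic_chain L hl hl0
  rw [hsum]
  refine isPeriod_sum _ _ fun i hi => ?_
  rw [Finset.mem_range] at hi
  obtain ⟨hxr, hxi, hvr, hvi⟩ := halg i hi
  exact isPeriod_integral_div_of_sq_eq_cubic ⟨hxr, hxi⟩ ⟨hvr, hvi⟩ (isAlgebraic_re_im h₂)
    (isAlgebraic_re_im h₃) (hcont i hi) (hsq i hi)

end Literature.NumberTheory.Transcendental
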